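import Literature.AlgebraicGeometry.AbelianSchemes.AbelianSchemeSteinOfArtinian
import Literature.AlgebraicGeometry.Morphisms.SteinOfArtinLevels
import Literature.AlgebraicGeometry.Morphisms.SteinOfNoetherianLevels
import HarnessLib

/-!
# An abelian scheme is universally Stein

Topic `Literature/AlgebraicGeometry/AbelianSchemes`; theorems only (no definition, no named fact, no
instance). For an abelian scheme `B → S` and a morphism `g : T → S`, the comorphism
`Γ(W, 𝒪_T) → Γ(π⁻¹W, 𝒪_{B ×_S T})` of the base change `π : B ×_S T → T` is bijective for every
open `W ⊆ T` — the Stein property `𝒪_T ⥲ π_*𝒪_{B_T}` (cohomological flatness in dimension `0`,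
[GortzWedhorn2023] Cor. 24.63; EGA III (7.8.6)), in the `hStein` binder shape of the tree's
`RigidifiedGluing.rigidifiedGluing_of_stein`: for `T` locally Noetherian over any `S`
(`baseChange_app_bijective_of_isLocallyNoetherian`), and for every `T` over a locally Noetherian `S`
(`baseChange_app_bijective`). Assembly of the Artin-local case (tree
`AbelianSchemeSteinOfArtinian.artinLevels_bijective_algebraMapΓ`, length induction), the passage from
Artin levels to Noetherian bases (tree `Morphisms/SteinOfArtinLevels`: formal levels over complete
local rings, completion descent, localisation, sheaf property) and from Noetherian levels to all bases
(tree `Morphisms/SteinOfNoetherianLevels`: Noetherian approximation); the reduced-base case is the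
tree's `AbelianSchemeSteinOfReduced`.

* `baseChange_app_bijective_of_isLocallyNoetherian`, `baseChange_appTop_bijective_of_isLocallyNoetherian`,
  `app_bijective_of_isLocallyNoetherian` — locally Noetherian `T` (any `S`);
* `baseChange_app_bijective`, `baseChange_appTop_bijective` — every `T`, locally Noetherian `S`.

## References
* [GortzWedhorn2023] U. Görtz, T. Wedhorn, *Algebraic Geometry II*, Cor. 24.63 (p. 404), Thm. 24.37.
-/

noncomputable section

open CategoryTheory CategoryTheory.Limits AlgebraicGeometry

universe u

namespace Literature.AlgebraicGeometry.AbelianSchemes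

namespace AbelianSchemeOver

variable {S : Scheme.{u}} (B : AbelianSchemeOver S)

/-- **An abelian scheme is universally Stein over locally Noetherian bases**: for `g : T → S` with
`T` locally Noetherian and every open `W ⊆ T`, `Γ(W, 𝒪_T) → Γ(π⁻¹W, 𝒪_{B ×_S T})` is bijective.
[cite: GortzWedhorn2023, Cor. 24.63 (p. 404)] -/
theorem baseChange_app_bijective_of_isLocallyNoetherian {T : Scheme.{u}} [IsLocallyNoetherian T]
    (g : T ⟶ S) (W : T.Opens) : Function.Bijective ((B.baseChange g).X.hom.app W) := by
  haveI := B.isProper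
  exact Morphisms.app_bijective_snd_of_artinLevels B.X.hom B.artinLevels_bijective_algebraMapΓ g W

/-- Global sections: `Γ(T, 𝒪_T) → Γ(B ×_S T, 𝒪)` is bijective for `T` locally Noetherian.
[cite: GortzWedhorn2023, Cor. 24.63 (p. 404)] -/
theorem baseChange_appTop_bijective_of_isLocallyNoetherian {T : Scheme.{u}} [IsLocallyNoetherian T]
    (g : T ⟶ S) : Function.Bijective (B.baseChange g).X.hom.appTop :=
  B.baseChange_app_bijective_of_isLocallyNoetherian g ⊤

/-- Over a locally Noetherian base `S` itself: `Γ(W, 𝒪_S) → Γ(p⁻¹W, 𝒪_B)` is bijective for every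
open `W ⊆ S` (no reducedness assumption, cf. the tree's `app_bijective_of_isReduced`).
[cite: GortzWedhorn2023, Cor. 24.63 (p. 404)] -/
theorem app_bijective_of_isLocallyNoetherian [IsLocallyNoetherian S] (W : S.Opens) :
    Function.Bijective (B.X.hom.app W) := by
  haveI := B.isProper
  -- `B ≅ B ×_S S` over `S`
  have h := Morphisms.app_bijective_snd_of_artinLevels B.X.hom B.artinLevels_bijective_algebraMapΓ
    (𝟙 S) W
  haveI : IsIso (pullback.fst B.X.hom (𝟙 S)) := inferInstance
  have e : B.X.hom = inv (pullback.fst B.X.hom (𝟙 S)) ≫ pullback.snd B.X.hom (𝟙 S) := by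
    rw [IsIso.eq_inv_comp, pullback.condition, Category.comp_id]
  rw [e, Scheme.Hom.comp_app]
  have : Function.Bijective (((inv (pullback.fst B.X.hom (𝟙 S))).app _).hom ∘
      ((pullback.snd B.X.hom (𝟙 S)).app W).hom) :=
    (ConcreteCategory.bijective_of_isIso _).comp h
  exact this

/-- **An abelian scheme over a locally Noetherian base is universally Stein** — the `hStein` binder of
the tree's `RigidifiedGluing.rigidifiedGluing_of_stein` verbatim: for EVERY scheme `T`, every `g : T → S`
and every open `W ⊆ T`, `Γ(W, 𝒪_T) → Γ(π⁻¹W, 𝒪_{B ×_S T})` is bijective (Noetherian affine levels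
by `Morphisms.bijective_algebraMapΓ_snd_of_artinLevels`, then all `T` by Noetherian approximation,
tree `Morphisms.app_bijective_snd_of_noetherianLevels`). [cite: GortzWedhorn2023, Cor. 24.63 (p. 404)] -/
theorem baseChange_app_bijective [IsLocallyNoetherian S] {T : Scheme.{u}} (g : T ⟶ S) (W : T.Opens) :
    Function.Bijective ((B.baseChange g).X.hom.app W) := by
  haveI := B.isProper
  exact Morphisms.app_bijective_snd_of_noetherianLevels B.X.hom
    (fun R _ _ i => Morphisms.bijective_algebraMapΓ_snd_of_artinLevels B.X.hom
      B.artinLevels_bijective_algebraMapΓ i) g W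

/-- Global sections, every `T` over a locally Noetherian `S`: `Γ(T, 𝒪_T) → Γ(B ×_S T, 𝒪)` is
bijective. [cite: GortzWedhorn2023, Cor. 24.63 (p. 404)] -/
theorem baseChange_appTop_bijective [IsLocallyNoetherian S] {T : Scheme.{u}} (g : T ⟶ S) :
    Function.Bijective (B.baseChange g).X.hom.appTop :=
  B.baseChange_app_bijective g ⊤

end AbelianSchemeOver

end Literature.AlgebraicGeometry.AbelianSchemes
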